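import Summits.HodgeConjecture.HodgeConjecture.Theses.IncidenceNodePeeling

/-!
# Route IncidenceNodePeeling — `PeelingBound` (support item stmt-HodgeConjecture-2352)

The peeling inequality: for a symmetric bilinear form `B` on a `ℚ`-vector space, pairwise
`B`-orthogonal vectors `δ₁, …, δ_k` with `B(δᵢ, δᵢ) = 2`, and a vector `ζ` with non-zero INTEGER
products `mᵢ = B(ζ, δᵢ)`, if the "peeled" vector `ζ - Σ (mᵢ/2) δᵢ` has `B`-square `≥ 0` then
`k ≤ 2 B(ζ, ζ)`.  Indeed `B(ζ - Σ (mᵢ/2) δᵢ, ζ - Σ (mᵢ/2) δᵢ) = B(ζ, ζ) - Σ mᵢ²/2` (expand and use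
orthogonality), and `mᵢ² ≥ 1`.  Elementary linear algebra; no named-fact hypothesis, no sorry.
-/

-- `Summit.HodgeConjecture.HodgeConjecture.Theorems` is the mandated namespace (single-problem
-- summit: Problem = Summit), which `linter.dupNamespace` flags on every declaration; the lakefile
-- turns the linter off tree-wide (weak option), restated here so stand-alone elaboration is
-- warning-free too.
set_option linter.dupNamespace false

namespace Summit.HodgeConjecture.HodgeConjecture.Theorems

/-- **Item stmt-HodgeConjecture-2352 (`PeelingBound`), route `IncidenceNodePeeling`**:
`B(ζ - Σ (mᵢ/2) δᵢ, ζ - Σ (mᵢ/2) δᵢ) = B(ζ,ζ) - Σ mᵢ²/2 ≥ 0` and `mᵢ² ≥ 1` give `k ≤ 2 B(ζ, ζ)`.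
[cite: Thomas2005Nodes, §2] -/
theorem incidenceNodePeeling_peelingBound_proof :
    Summit.HodgeConjecture.HodgeConjecture.Theses.IncidenceNodePeeling.PeelingBound := by
  intro V _ _ B k δ ζ hsymm horth hnorm hint hnonneg
  set c : Fin k → ℚ := fun i ↦ B ζ (δ i) with hc_def
  set w : V := ∑ i, (c i / 2) • δ i with hw_def
  have hcζ : ∀ i, B ζ (δ i) = c i := fun i ↦ rfl
  have hδζ : ∀ i, B (δ i) ζ = c i := fun i ↦ by rw [← hcζ]; exact hsymm.eq (δ i) ζ
  -- the four terms of the expansion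
  have hζw : B ζ w = ∑ i, c i / 2 * c i := by
    rw [hw_def, map_sum]
    exact Finset.sum_congr rfl fun i _ ↦ by rw [map_smul, smul_eq_mul, hcζ]
  have hBw : B w = ∑ i, (c i / 2) • B (δ i) := by
    rw [hw_def, map_sum]
    exact Finset.sum_congr rfl fun i _ ↦ by rw [map_smul]
  have hwζ : B w ζ = ∑ i, c i / 2 * c i := by
    rw [hBw, LinearMap.sum_apply]
    exact Finset.sum_congr rfl fun i _ ↦ by rw [LinearMap.smul_apply, smul_eq_mul, hδζ]
  have hδw : ∀ i, B (δ i) w = c i / 2 * 2 := fun i ↦ by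
    rw [hw_def, map_sum, Finset.sum_eq_single i]
    · rw [map_smul, smul_eq_mul, hnorm]
    · intro j _ hji
      rw [map_smul, smul_eq_mul, horth i j (Ne.symm hji), mul_zero]
    · intro h
      exact absurd (Finset.mem_univ i) h
  have hww : B w w = ∑ i, c i / 2 * (c i / 2 * 2) := by
    rw [hBw, LinearMap.sum_apply]
    exact Finset.sum_congr rfl fun i _ ↦ by rw [LinearMap.smul_apply, smul_eq_mul, hδw]
  -- the expansion
  have e1 : ∑ i, c i / 2 * c i = (∑ i, c i ^ 2) / 2 := by
    rw [Finset.sum_div]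
    exact Finset.sum_congr rfl fun i _ ↦ by ring
  have e2 : ∑ i, c i / 2 * (c i / 2 * 2) = (∑ i, c i ^ 2) / 2 := by
    rw [Finset.sum_div]
    exact Finset.sum_congr rfl fun i _ ↦ by ring
  have hexp : B (ζ - w) (ζ - w) = B ζ ζ - (∑ i, c i ^ 2) / 2 := by
    rw [map_sub B ζ w, LinearMap.sub_apply, map_sub, map_sub, hζw, hwζ, hww, e1, e2]
    ring
  -- `mᵢ² ≥ 1`
  have hsum : (k : ℚ) ≤ ∑ i, c i ^ 2 := by
    calc (k : ℚ) = ∑ _i : Fin k, (1 : ℚ) := by simp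
      _ ≤ ∑ i, c i ^ 2 := Finset.sum_le_sum fun i _ ↦ ?_
    obtain ⟨hne, m, hm⟩ := hint i
    have hm0 : m ≠ 0 := by
      rintro rfl
      exact hne (by rw [hm]; simp)
    have h1 : (1 : ℤ) ≤ m ^ 2 := (one_le_sq_iff_one_le_abs m).2 (Int.one_le_abs hm0)
    rw [← hcζ, hm]
    exact_mod_cast h1
  rw [hexp] at hnonneg
  linarith

end Summit.HodgeConjecture.HodgeConjecture.Theorems
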